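import Summits.QuantumAdvantage.QuantumAdvantage.Theorems.AnchorDialMulti
import Summits.QuantumAdvantage.QuantumAdvantage.Theorems.HolonomyDialChain

/-!
# AnchorDial — part 22 «ChainF» (cell decomp-qadv, seat lens-2, generation 15; supports item 26531 `ExactnessDial.PolyLossOddU3`)

§E of the g15 node «GaugeDial»: the `(F+1)`-block Smolensky chain.  `chainP` (prefix-parity chain polynomial), flip
sites `siteF t L F i = t + (i+1)L`, the hidden sign vector `zvecF b x i = zpar x (b_i+1)`, `odd_zvecF_iff`,
`pieceF_le`, the equidistribution predicate `EquiF N F D' b η` (every class `{E = 1}` of degree `≤ D'` meets each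
fibre `{zvecF = z}` of the odd class in at most `2^{-(F+1)}·#{E = 1} + η` points) and `equiF_of`.  Namespace `…Theorems.AnchorDial`; imports part 21.  Verbatim from the node file; no `sorry`, no `native_decide`, no instances/notation; lint-clean without the unusedVariables switch.
-/

set_option linter.dupNamespace false

/-! ## §E  The `(F+1)`-block Smolensky chain: equidistribution of `F` prefix parities (general `F`) -/

noncomputable section

open scoped Classical

namespace Summit.QuantumAdvantage.QuantumAdvantage.Theorems.AnchorDial

open Finset
open Literature.Computability.QuantumComplexity Literature.Computability.QuantumComplexity.RingHLF
open Literature.Computability.MetaComplexity Literature.Computability.MetaComplexity.Smolensky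
open Summit.QuantumAdvantage.AdviceFreeQNC0
open Summit.QuantumAdvantage.QuantumAdvantage.Theorems.HolonomyDial (gCond selP selP_mem selP_apply indP indP_mem indP_apply)

variable {N : ℕ}

section ChainF

/-- prefix-sign conditions: `psgn x (p + i·L) = v i` for all `i ≤ j`. -/
def PConds (p L : ℕ) (v : ℕ → ZMod 3) (j : ℕ) (x : Fin N → Bool) : Prop :=
  ∀ i, i ≤ j → psgn x (p + i * L) = v i

/-- AnchorDialChainF helper `pConds_zero_iff` (decomp-qadv land package; see the module docstring). -/
theorem pConds_zero_iff (p L : ℕ) (v : ℕ → ZMod 3) (x : Fin N → Bool) :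
    PConds p L v 0 x ↔ psgn x p = v 0 := by
  constructor
  · intro h; simpa using h 0 le_rfl
  · intro h i hi
    obtain rfl : i = 0 := Nat.le_zero.1 hi
    simpa using h

/-- AnchorDialChainF helper `pConds_succ_iff` (decomp-qadv land package; see the module docstring). -/
theorem pConds_succ_iff (p L : ℕ) (v : ℕ → ZMod 3) (j : ℕ) (x : Fin N → Bool) :
    PConds p L v (j + 1) x ↔ PConds p L v j x ∧ psgn x (p + (j + 1) * L) = v (j + 1) := by
  constructor
  · intro h; exact ⟨fun i hi => h i (Nat.le_succ_of_le hi), h (j + 1) le_rfl⟩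
  · rintro ⟨h, h'⟩ i hi
    rcases Nat.lt_or_ge i (j + 1) with hlt | hge
    · exact h i (Nat.lt_succ_iff.1 hlt)
    · obtain rfl : i = j + 1 := le_antisymm hi hge
      exact h'

/-- a prefix sign is blind to a later block. -/
theorem psgn_joinAt_of_le {s m k : ℕ} (hk : k ≤ s) (ρ : Fin N → Bool) (w : Fin m → Bool) :
    psgn (joinAt s m ρ w) k = psgn ρ k := by
  rw [psgn_eq_bsgn, psgn_eq_bsgn]
  exact bsgn_joinAt_of_disjoint (s := s) (m := m) (s' := 0) (m' := k) (Or.inl (by omega)) ρ w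

/-- AnchorDialChainF helper `pm_solve` (decomp-qadv land package; see the module docstring). -/
theorem pm_solve : ∀ a b c : ZMod 3, (a = 1 ∨ a = -1) → (a * b = c ↔ b = a * c) := by decide

/-- AnchorDialChainF helper `pm_tail` (decomp-qadv land package; see the module docstring). -/
theorem pm_tail : ∀ a r : ZMod 3, (r = 1 ∨ r = -1) → (a * r = -1 ↔ a = -r) := by decide

/-- **the prefix-sign chain** (general length): conditioning a degree-`D` event on `j` successive prefix signs at
`p + L, …, p + jL` (blocks of odd length `L ≥ 3`, budget `K·2D·C(L,L/2) ≤ 2^L`) multiplies its size by `2^{-j}` up to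
`(2^j - 1)·2^N / K`. -/
theorem chainP {p L D K : ℕ} (hL : Odd L) (hL3 : 3 ≤ L) (hK : K * ((D + D) * L.choose (L / 2)) ≤ 2 ^ L)
    {P : CubeFn (ZMod 3) N} (hP : P ∈ lowDeg (ZMod 3) N D)
    (R : (Fin N → Bool) → Prop) [DecidablePred R] (J : ℕ) (hJ : p + (J + 1) * L ≤ N)
    (hR : ∀ j, j ≤ J → ∀ ρ (w w' : Fin L → Bool), R (joinAt (p + j * L) L ρ w) → R (joinAt (p + j * L) L ρ w'))
    (v : ℕ → ZMod 3) (hv : ∀ i, v i = 1 ∨ v i = -1) (hR0 : ∀ x, R x → psgn x p = v 0) :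
    ∀ j, j ≤ J + 1 →
      K * (2 ^ j * (univ.filter fun x => P x = 1 ∧ R x ∧ PConds p L v j x).card) ≤
        K * (univ.filter fun x => P x = 1 ∧ R x).card + (2 ^ j - 1) * 2 ^ N := by
  intro j
  induction j with
  | zero =>
    intro _
    have e : (univ.filter fun x => P x = 1 ∧ R x ∧ PConds p L v 0 x) = univ.filter fun x => P x = 1 ∧ R x := by
      refine filter_congr fun x _ => ?_
      rw [pConds_zero_iff]
      exact ⟨fun h => ⟨h.1, h.2.1⟩, fun h => ⟨h.1, h.2, hR0 x h.2⟩⟩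
    rw [e]; simp
  | succ j ih =>
    intro hj
    have ih' := ih (by omega)
    have h1 : (j + 1) * L ≤ (J + 1) * L := Nat.mul_le_mul_right _ hj
    have hs : p + j * L + L ≤ N := by
      rw [show p + j * L + L = p + (j + 1) * L by ring]; omega
    have hRj : ∀ ρ (w w' : Fin L → Bool), (R (joinAt (p + j * L) L ρ w) ∧ PConds p L v j (joinAt (p + j * L) L ρ w)) →
        (R (joinAt (p + j * L) L ρ w') ∧ PConds p L v j (joinAt (p + j * L) L ρ w')) := by
      rintro ρ w w' ⟨hRw, hC⟩
      refine ⟨hR j (by omega) ρ w w' hRw, fun i hi => ?_⟩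
      have hle : p + i * L ≤ p + j * L := by have := Nat.mul_le_mul_right L hi; omega
      rw [psgn_joinAt_of_le hle, ← psgn_joinAt_of_le hle ρ w]
      exact hC i hi
    have hτ : v j * v (j + 1) = 1 ∨ v j * v (j + 1) = -1 := Summit.QuantumAdvantage.QuantumAdvantage.Theorems.HolonomyDial.sgn_mul _ _ (hv j) (hv (j + 1))
    have hstep := (step_two_sided (N := N) (s := p + j * L) (m := L) (D := D) (K := K) hs hL hL3 hK hP
      (fun x => R x ∧ PConds p L v j x) hRj (v j * v (j + 1)) hτ).1
    have e1 : (univ.filter fun x => P x = 1 ∧ (R x ∧ PConds p L v j x) ∧ bsgn (p + j * L) L x = v j * v (j + 1)) =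
        univ.filter fun x => P x = 1 ∧ R x ∧ PConds p L v (j + 1) x := by
      refine filter_congr fun x _ => ?_
      rw [pConds_succ_iff]
      have hadd : psgn x (p + (j + 1) * L) = psgn x (p + j * L) * bsgn (p + j * L) L x := by
        rw [show p + (j + 1) * L = p + j * L + L by ring]; exact psgn_add x _ _
      constructor
      · rintro ⟨hP1, ⟨hRx, hC⟩, hb⟩
        refine ⟨hP1, hRx, hC, ?_⟩
        rw [hadd, hC j le_rfl, hb]
        exact Summit.QuantumAdvantage.QuantumAdvantage.Theorems.HolonomyDial.sgn_eval' _ _ (hv j)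
      · rintro ⟨hP1, hRx, hC, hlast⟩
        refine ⟨hP1, ⟨hRx, hC⟩, ?_⟩
        have h' := hadd.symm.trans hlast
        rw [hC j le_rfl] at h'
        exact (pm_solve _ _ _ (hv j)).1 h'
    rw [e1] at hstep
    have hpow : 2 ^ (j + 1) = 2 * 2 ^ j := by ring
    have h2 := Nat.mul_le_mul_left (2 ^ j) hstep
    have eq1 : 2 ^ j * (K * (2 * (univ.filter fun x => P x = 1 ∧ R x ∧ PConds p L v (j + 1) x).card)) =
        K * (2 ^ (j + 1) * (univ.filter fun x => P x = 1 ∧ R x ∧ PConds p L v (j + 1) x).card) := by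
      rw [hpow]; ring
    have eq2 : 2 ^ j * (K * (univ.filter fun x => P x = 1 ∧ R x ∧ PConds p L v j x).card + 2 ^ N) =
        K * (2 ^ j * (univ.filter fun x => P x = 1 ∧ R x ∧ PConds p L v j x).card) + 2 ^ j * 2 ^ N := by ring
    rw [eq1, eq2] at h2
    have h1le : 1 ≤ 2 ^ j := Nat.one_le_two_pow
    have eq3 : (2 ^ (j + 1) - 1) * 2 ^ N = (2 ^ j - 1) * 2 ^ N + 2 ^ j * 2 ^ N := by
      rw [hpow, ← Nat.add_mul]; congr 1; omega
    rw [eq3]; omega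

/-- sites `b_i = t + (i+1)·L`, `i < F`. -/
def siteF (t L F : ℕ) : Fin F → ℕ := fun i => t + (i.val + 1) * L

/-- the vector of the `F` prefix parities `u_i = zpar x (b_i + 1)`. -/
def zvecF {F : ℕ} (b : Fin F → ℕ) (x : Fin N → Bool) : Fin F → Bool := fun i => zpar x (b i + 1)

/-- extension of a sign vector to `ℕ`. -/
def zExt {F : ℕ} (z : Fin F → Bool) (n : ℕ) : Bool := if h : n < F then z ⟨n, h⟩ else false

/-- the prefix-sign targets of a class `(ρ₀, ρe)` and a sign vector `z`. -/
def vTarget {F : ℕ} (z : Fin F → Bool) (ρ₀ ρe : ZMod 3) (i : ℕ) : ZMod 3 :=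
  if i = 0 then ρ₀ else if i ≤ F then sg (zExt z (i - 1)) else -ρe

/-- AnchorDialChainF helper `vTarget_pm` (decomp-qadv land package; see the module docstring). -/
theorem vTarget_pm {F : ℕ} (z : Fin F → Bool) {ρ₀ ρe : ZMod 3} (hρ₀ : ρ₀ = 1 ∨ ρ₀ = -1)
    (hρe : ρe = 1 ∨ ρe = -1) (i : ℕ) : vTarget z ρ₀ ρe i = 1 ∨ vTarget z ρ₀ ρe i = -1 := by
  unfold vTarget
  split_ifs with h0 hF
  · exact hρ₀
  · exact sg_cases _
  · rcases hρe with h | h <;> simp [h]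

/-- «odd with prescribed `F` prefix parities», inside a (prefix, tail) class, is the conjunction of the `F + 2`
prefix-sign conditions. -/
theorem odd_zvecF_iff {t L F : ℕ} (hfit : t + 1 + (F + 1) * L ≤ N) (x : Fin N → Bool) {ρ₀ ρe : ZMod 3}
    (hρe : ρe = 1 ∨ ρe = -1)
    (hc0 : bsgn 0 (t + 1) x = ρ₀) (hce : bsgn (t + 1 + (F + 1) * L) (N - (t + 1 + (F + 1) * L)) x = ρe)
    (z : Fin F → Bool) :
    (OddZeros x ∧ zvecF (siteF t L F) x = z) ↔ PConds (t + 1) L (vTarget z ρ₀ ρe) (F + 1) x := by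
  have hp0 : psgn x (t + 1) = ρ₀ := by rw [psgn_eq_bsgn, hc0]
  have hN : psgn x N = psgn x (t + 1 + (F + 1) * L) * ρe := by
    have h := psgn_add x (t + 1 + (F + 1) * L) (N - (t + 1 + (F + 1) * L))
    rwa [show t + 1 + (F + 1) * L + (N - (t + 1 + (F + 1) * L)) = N by omega, hce] at h
  constructor
  · rintro ⟨hodd, hz⟩ i hi
    unfold vTarget
    split_ifs with h0 hF
    · subst h0; simpa using hp0
    · have hi1 : i - 1 < F := by omega
      have hzi := congrFun hz ⟨i - 1, hi1⟩
      simp only [zvecF, siteF] at hzi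
      rw [show t + (i - 1 + 1) * L + 1 = t + 1 + i * L by
        rw [show i - 1 + 1 = i by omega]; ring] at hzi
      rw [psgn_eq_sg, hzi]
      unfold zExt; rw [dif_pos hi1]
    · have hiF : i = F + 1 := by omega
      subst hiF
      have hodd' : psgn x N = -1 := (oddZeros_iff_psgn x).1 hodd
      rw [hN] at hodd'
      exact (pm_tail _ _ hρe).1 hodd'
  · intro h
    have hlast := h (F + 1) le_rfl
    have hvl : vTarget z ρ₀ ρe (F + 1) = -ρe := by
      unfold vTarget; rw [if_neg (by omega), if_neg (by omega)]
    rw [hvl] at hlast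
    refine ⟨(oddZeros_iff_psgn x).2 (by rw [hN]; exact (pm_tail _ _ hρe).2 hlast), ?_⟩
    funext i
    have hi := h (i.val + 1) (by omega)
    have hvi : vTarget z ρ₀ ρe (i.val + 1) = sg (z i) := by
      unfold vTarget zExt
      rw [if_neg (by omega), if_pos (by omega), show i.val + 1 - 1 = i.val by omega, dif_pos i.isLt]
    rw [hvi, psgn_eq_sg] at hi
    simp only [zvecF, siteF]
    rw [show t + (i.val + 1) * L + 1 = t + 1 + (i.val + 1) * L by ring]
    exact sg_inj hi

/-- one (prefix, tail) class: the chain bound for the piece of `{odd ∧ E = 1 ∧ zvecF = z}` in the class. -/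
theorem pieceF_le {t L F D' K : ℕ} (hL : Odd L) (hL3 : 3 ≤ L) (hfit : t + 1 + (F + 1) * L ≤ N)
    (hK : K * ((D' + D') * L.choose (L / 2)) ≤ 2 ^ L)
    {E : CubeFn (ZMod 3) N} (hE : E ∈ lowDeg (ZMod 3) N D') (z : Fin F → Bool)
    (ρ₀ ρe : ZMod 3) (hρ₀ : ρ₀ = 1 ∨ ρ₀ = -1) (hρe : ρe = 1 ∨ ρe = -1) :
    K * (2 ^ (F + 1) * (univ.filter fun x : Fin N → Bool =>
        ((OddZeros x ∧ E x = 1 ∧ zvecF (siteF t L F) x = z) ∧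
          bsgn 0 (t + 1) x = ρ₀) ∧ bsgn (t + 1 + (F + 1) * L) (N - (t + 1 + (F + 1) * L)) x = ρe).card) ≤
      K * (univ.filter fun x : Fin N → Bool =>
        (E x = 1 ∧ bsgn 0 (t + 1) x = ρ₀) ∧ bsgn (t + 1 + (F + 1) * L) (N - (t + 1 + (F + 1) * L)) x = ρe).card +
        (2 ^ (F + 1) - 1) * 2 ^ N := by
  set R : (Fin N → Bool) → Prop := fun x =>
    bsgn 0 (t + 1) x = ρ₀ ∧ bsgn (t + 1 + (F + 1) * L) (N - (t + 1 + (F + 1) * L)) x = ρe with hRdef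
  have hRbl : ∀ j, j ≤ F → ∀ ρ (w w' : Fin L → Bool), R (joinAt (t + 1 + j * L) L ρ w) → R (joinAt (t + 1 + j * L) L ρ w') := by
    intro j hj ρ w w' h
    simp only [hRdef] at h ⊢
    have hjL : (j + 1) * L ≤ (F + 1) * L := Nat.mul_le_mul_right _ (by omega)
    rw [bsgn_joinAt_of_disjoint (s := t + 1 + j * L) (m := L) (s' := 0) (m' := t + 1) (Or.inl (by omega)),
      bsgn_joinAt_of_disjoint (s := t + 1 + j * L) (m := L) (s' := t + 1 + (F + 1) * L)
        (m' := N - (t + 1 + (F + 1) * L)) (Or.inr (by rw [show t + 1 + j * L + L = t + 1 + (j + 1) * L by ring]; omega))] at h ⊢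
    exact h
  have hc := chainP (N := N) (p := t + 1) hL hL3 hK hE R F hfit hRbl (vTarget z ρ₀ ρe) (vTarget_pm z hρ₀ hρe)
    (fun x hx => by rw [psgn_eq_bsgn]; unfold vTarget; rw [if_pos rfl]; exact hx.1) (F + 1) le_rfl
  have e1 : (univ.filter fun x : Fin N → Bool =>
        ((OddZeros x ∧ E x = 1 ∧ zvecF (siteF t L F) x = z) ∧
          bsgn 0 (t + 1) x = ρ₀) ∧ bsgn (t + 1 + (F + 1) * L) (N - (t + 1 + (F + 1) * L)) x = ρe) =
      univ.filter fun x : Fin N → Bool => E x = 1 ∧ R x ∧ PConds (t + 1) L (vTarget z ρ₀ ρe) (F + 1) x := by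
    refine filter_congr fun x _ => ?_
    constructor
    · rintro ⟨⟨⟨hodd, hE1, hz⟩, h0⟩, he⟩
      exact ⟨hE1, ⟨h0, he⟩, (odd_zvecF_iff hfit x hρe h0 he z).1 ⟨hodd, hz⟩⟩
    · rintro ⟨hE1, hR, hC⟩
      obtain ⟨hodd, hz⟩ := (odd_zvecF_iff hfit x hρe hR.1 hR.2 z).2 hC
      exact ⟨⟨⟨hodd, hE1, hz⟩, hR.1⟩, hR.2⟩
  have e2 : (univ.filter fun x : Fin N → Bool =>
        (E x = 1 ∧ bsgn 0 (t + 1) x = ρ₀) ∧ bsgn (t + 1 + (F + 1) * L) (N - (t + 1 + (F + 1) * L)) x = ρe) =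
      univ.filter fun x : Fin N → Bool => E x = 1 ∧ R x :=
    filter_congr fun x _ => and_assoc
  rw [e1, e2]
  exact hc

/-- general-`F` equidistribution of the prefix-parity vector on degree-`D'` events: each value takes at most
`2^{-(F+1)}` of `{E = 1}` among the odd inputs, up to `η`. -/
def EquiF (N F D' : ℕ) (b : Fin F → ℕ) (η : ℕ) : Prop :=
  ∀ E ∈ lowDeg (ZMod 3) N D', ∀ z : Fin F → Bool,
    2 ^ (F + 1) * (univ.filter fun x : Fin N → Bool => OddZeros x ∧ E x = 1 ∧ zvecF b x = z).card ≤
      (univ.filter fun x : Fin N → Bool => E x = 1).card + 2 ^ (F + 1) * η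

/-- **`EquiF` at admissible sites** (`L` odd `≥ 3`, `t + 1 + (F+1)L ≤ N`, `2^47·2D'·C(L,L/2) ≤ 2^L`, `N ≥ 47`), `η = 2^(N-45)`. -/
theorem equiF_of {t L F D' : ℕ} (hL : Odd L) (hL3 : 3 ≤ L) (hfit : t + 1 + (F + 1) * L ≤ N) (hN : 47 ≤ N)
    (hK : 140737488355328 * ((D' + D') * L.choose (L / 2)) ≤ 2 ^ L) :
    EquiF N F D' (siteF t L F) (2 ^ (N - 45)) := by
  intro E hE z
  have p11 := pieceF_le hL hL3 hfit hK hE z 1 1 (Or.inl rfl) (Or.inl rfl)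
  have p1m := pieceF_le hL hL3 hfit hK hE z 1 (-1) (Or.inl rfl) (Or.inr rfl)
  have pm1 := pieceF_le hL hL3 hfit hK hE z (-1) 1 (Or.inr rfl) (Or.inl rfl)
  have pmm := pieceF_le hL hL3 hfit hK hE z (-1) (-1) (Or.inr rfl) (Or.inr rfl)
  set q := t + 1 + (F + 1) * L with hq
  have hS := split_sign (N := N) (fun x => OddZeros x ∧ E x = 1 ∧ zvecF (siteF t L F) x = z) 0 (t + 1)
  have hS1 := split_sign (N := N) (fun x => (OddZeros x ∧ E x = 1 ∧ zvecF (siteF t L F) x = z) ∧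
      bsgn 0 (t + 1) x = 1) q (N - q)
  have hSm := split_sign (N := N) (fun x => (OddZeros x ∧ E x = 1 ∧ zvecF (siteF t L F) x = z) ∧
      bsgn 0 (t + 1) x = -1) q (N - q)
  have hY := split_sign (N := N) (fun x => E x = 1) 0 (t + 1)
  have hY1 := split_sign (N := N) (fun x => E x = 1 ∧ bsgn 0 (t + 1) x = 1) q (N - q)
  have hYm := split_sign (N := N) (fun x => E x = 1 ∧ bsgn 0 (t + 1) x = -1) q (N - q)
  have hpow : 2 ^ N = 35184372088832 * 2 ^ (N - 45) := by
    rw [show (35184372088832 : ℕ) = 2 ^ 45 by norm_num, ← pow_add]; congr 1; omega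
  -- abbreviations
  set S := (univ.filter fun x : Fin N → Bool => OddZeros x ∧ E x = 1 ∧ zvecF (siteF t L F) x = z).card
  set Y := (univ.filter fun x : Fin N → Bool => E x = 1).card
  set S1 := (univ.filter fun x => (OddZeros x ∧ E x = 1 ∧ zvecF (siteF t L F) x = z) ∧ bsgn 0 (t + 1) x = 1).card
  set Sm := (univ.filter fun x => (OddZeros x ∧ E x = 1 ∧ zvecF (siteF t L F) x = z) ∧ bsgn 0 (t + 1) x = -1).card
  set S11 := (univ.filter fun x => ((OddZeros x ∧ E x = 1 ∧ zvecF (siteF t L F) x = z) ∧ bsgn 0 (t + 1) x = 1) ∧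
    bsgn q (N - q) x = 1).card
  set S1m := (univ.filter fun x => ((OddZeros x ∧ E x = 1 ∧ zvecF (siteF t L F) x = z) ∧ bsgn 0 (t + 1) x = 1) ∧
    bsgn q (N - q) x = -1).card
  set Sm1 := (univ.filter fun x => ((OddZeros x ∧ E x = 1 ∧ zvecF (siteF t L F) x = z) ∧ bsgn 0 (t + 1) x = -1) ∧
    bsgn q (N - q) x = 1).card
  set Smm := (univ.filter fun x => ((OddZeros x ∧ E x = 1 ∧ zvecF (siteF t L F) x = z) ∧ bsgn 0 (t + 1) x = -1) ∧
    bsgn q (N - q) x = -1).card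
  set Y1 := (univ.filter fun x => E x = 1 ∧ bsgn 0 (t + 1) x = 1).card
  set Ym := (univ.filter fun x => E x = 1 ∧ bsgn 0 (t + 1) x = -1).card
  set Y11 := (univ.filter fun x => (E x = 1 ∧ bsgn 0 (t + 1) x = 1) ∧ bsgn q (N - q) x = 1).card
  set Y1m := (univ.filter fun x => (E x = 1 ∧ bsgn 0 (t + 1) x = 1) ∧ bsgn q (N - q) x = -1).card
  set Ym1 := (univ.filter fun x => (E x = 1 ∧ bsgn 0 (t + 1) x = -1) ∧ bsgn q (N - q) x = 1).card
  set Ymm := (univ.filter fun x => (E x = 1 ∧ bsgn 0 (t + 1) x = -1) ∧ bsgn q (N - q) x = -1).card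
  set K : ℕ := 140737488355328 with hKdef
  set W : ℕ := 2 ^ (F + 1) with hW
  have hSsum : K * (W * S) = K * (W * S11) + K * (W * S1m) + K * (W * Sm1) + K * (W * Smm) := by
    rw [hS, hS1, hSm]; ring
  have hYsum : K * Y = K * Y11 + K * Y1m + K * Ym1 + K * Ymm := by rw [hY, hY1, hYm]; ring
  have hW1 : 1 ≤ W := Nat.one_le_two_pow
  have herr : 4 * ((W - 1) * 2 ^ N) ≤ K * (W * 2 ^ (N - 45)) := by
    have h1 : (W - 1) * 2 ^ N ≤ W * 2 ^ N := Nat.mul_le_mul_right _ (Nat.sub_le _ _)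
    have h2 : K * (W * 2 ^ (N - 45)) = 4 * (W * 2 ^ N) := by rw [hpow, hKdef]; ring
    rw [h2]; exact Nat.mul_le_mul_left 4 h1
  have htot : K * (W * S) ≤ K * Y + K * (W * 2 ^ (N - 45)) := by
    rw [hSsum, hYsum]; omega
  rw [← Nat.mul_add] at htot
  exact Nat.le_of_mul_le_mul_left htot (by norm_num)

end ChainF

end Summit.QuantumAdvantage.QuantumAdvantage.Theorems.AnchorDial

end
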